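import Summits.HodgeConjecture.CorCM.ReflexTwinSlotRank
import Summits.HodgeConjecture.CorCM.PairFlipSexticFullSignedPermutations
import Summits.HodgeConjecture.CorCM.QuarticCMSubfieldOfOcticHodge
import Summits.HodgeConjecture.CorCM.CyclicCMSurfaceTimesCMHodge
import Literature.AlgebraicGeometry.Motives.HodgeStructureOfCMType
import HarnessLib

/-!
# A CM threefold with generic sextic field against a fourfold with CM by the TWIN of the reflex field: ADDITIVE

COR-CM (cell `pub-hodgecm2`, binder seat `b16` gen 45, count-neutral claim REFLEX-OCTIC-34 part II, file T4); NEW as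
stated, hence under `Summits/`.  Theorems only; no definition, no named fact, no `sorry`.

Setting: `K_{i₀}` a sextic CM field whose Galois closure `L` has degree `48` (`Gal = ℤ₂ × 𝔖₄ = ℤ₂ ≀ 𝔖₃`; every type
is nondegenerate, realisations are SIMPLE CM threefolds `T`), type `Φ_T = Φ_{i₀}`; `K*` a CM field with an embedding
`ψ₀` whose fixer is `Stab(Φ_T)` (the reflex field; octic).  `L` contains exactly TWO imaginary quadratic fields,
`k₁ ⊂ K*` (fixed by the signed permutations with an even number of sign changes) and `k₂ ⊄ K*` (fixed by the
ROTATIONS `𝔖₄`), and exactly two octic CM fields up to isomorphism: `K* = M·k₁` and its TWIN `K' = M·k₂`, where `M` is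
the totally real quartic `𝔖₄`-field `(K*)⁺` (whose cubic resolvent field is `K_{i₀}⁺`).  This file treats
`K_{i₁} = K'`: an octic CM field containing a totally real quartic field `M` that also embeds into `K*`, and an imaginary
quadratic field `k` inside `L` (the action of `Aut(ℂ)` on `Hom(k, ℂ)` factors through `Hom(K_{i₀}, ℂ)`) NOT contained
in `K*` (some automorphism stabilising `Φ_T` moves `k`).

> **Theorem** (`cmFamilyRank_eq_add_three_of_reflexTwin`, `isNondegenerateFamily_iff_of_reflexTwin`).  For EVERY CM
> type `Ψ' = Φ_{i₁}` of `K'`: `rank(Φ_T, Ψ') = rank(Ψ') + 3` — `Hg(T × F') = Hg(T) × Hg(F')` — and `(Φ_T, Ψ')` is a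
> nondegenerate family iff `Ψ'` is nondegenerate (then the Hodge conjecture holds on all `T^a × F'^b`,
> `hodgeConjectureFor_prod_of_reflexTwin`).

Contrast with the reflex field itself (`PairFlipSexticTimesReflexOcticHodge`): there the rank collapses on the two
Hamming-ball types.  Mechanism: `Hom(K', ℂ) ≅ Hom(k, ℂ) × Hom(M, ℂ) = {±} × (cube/antipode)`, on which the pure
transposition `t` (from `[L : ℚ] = 48`, `PairFlipSexticFullSignedPermutations`) composed with a flip acts with fixed
points; `ReflexTwinSlotRank` (no common constituent: `Anti(Hom K_T) ≅ det ⊗ std ⊗ sgn` versus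
`Anti(Hom K') ≅ det ⊗ (1 ⊕ std)`).

## References

* [Dodson1984] B. Dodson, *The structure of Galois groups of CM-fields*, Trans. AMS 283 (1984), §5.1.2, Prop. 5.2.2,
  §3.3.2.
* [Gordon1999HodgeAVSurvey] B. B. Gordon, *A survey of the Hodge conjecture for abelian varieties*, §3, 7.5–7.7, 10.10.
* [Shimura1998] G. Shimura, *Abelian Varieties with Complex Multiplication and Modular Functions*, §8.3–8.4.
-/

noncomputable section

open CategoryTheory CategoryTheory.Limits NumberField Module
open scoped BigOperators Classical

namespace Summit.HodgeConjecture.CorCM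

open Literature.NumberTheory.ComplexMultiplication
open Literature.AlgebraicGeometry.Motives (AbelianVariety CMType)
open Literature.AlgebraicGeometry.HodgeTheory
open Literature.AlgebraicGeometry.ComplexMultiplication (IsCMTypeRealisation)
open Literature.AlgebraicGeometry.VanGeemen1994 (hodgeClassSpan)
open Literature.AlgebraicGeometry.Pohlmann1968
open Literature.Barriers.HodgeConjecture (divisorClassesSpan)

section Types

variable {I : Type} {K : I → Type} [∀ i, Field (K i)] [∀ i, NumberField (K i)] [∀ i, IsCMField (K i)] [Fintype I]

/-- Every embedding of a subfield extends (`#fibre · [k:ℚ] = [L:ℚ] > 0`). [cite: Lang2002, V §2 Thm. 2.8] -/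
theorem exists_comp_eq_of_embedding {k L : Type} [Field k] [NumberField k] [Field L] [NumberField L] (e : k →+* L)
    (x : k →+* ℂ) : ∃ y : L →+* ℂ, y.comp e = x := by
  classical
  by_contra h
  push Not at h
  have hcard := card_filter_comp_eq_mul_finrank e x
  have h0 : (Finset.univ.filter fun y : L →+* ℂ => y.comp e = x).card = 0 :=
    Finset.card_eq_zero.2 (Finset.filter_eq_empty_iff.2 fun y _ => h y)
  rw [h0, zero_mul] at hcard
  exact absurd hcard.symm (ne_of_gt finrank_pos)

/-- **`T × F'` is ADDITIVE for the twin `K'` of the reflex field**: `rank(Φ_T, Ψ') = rank(Ψ') + 3` for every type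
`Ψ'` of `K_{i₁} = K'` (hypotheses as in the module docstring). [cite: Dodson1984, §5.1.2 and Prop. 5.2.2]
[cite: Gordon1999HodgeAVSurvey, §3 Theorem (1), 7.5] -/
theorem cmFamilyRank_eq_add_three_of_reflexTwin {i₀ i₁ : I} (h01 : i₀ ≠ i₁) (hI : ∀ j, j = i₀ ∨ j = i₁)
    (h6 : finrank ℚ (K i₀) = 6) (L : Type) [Field L] [NumberField L] [IsNormalClosure ℚ (K i₀) L]
    (hL : finrank ℚ L = 48) (Φ : ∀ i, CMType (K i))
    {Ks : Type} [Field Ks] [NumberField Ks] [IsCMField Ks] {ψ₀ : Ks →+* ℂ}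
    (hψ₀ : ∀ σ : ℂ ≃+* ℂ, σ • ψ₀ = ψ₀ ↔ ∀ x : K i₀ →+* ℂ, σ • x ∈ (Φ i₀).1 ↔ x ∈ (Φ i₀).1)
    {M : Type} [Field M] [NumberField M] (eM : M →+* K i₁) (eM' : M →+* Ks) (h4M : finrank ℚ M = 4)
    (hMreal : ∀ μ : M →+* ℂ, (starRingAut : ℂ ≃+* ℂ) • μ = μ) (h8 : finrank ℚ (K i₁) = 8)
    {k : Type} [Field k] [NumberField k] (κ : k →+* K i₁) (h2k : finrank ℚ k = 2)
    (hkim : ∀ lam : k →+* ℂ, (starRingAut : ℂ ≃+* ℂ) • lam ≠ lam)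
    (hkL : ∀ σ σ' : ℂ ≃+* ℂ, (∀ z : K i₀ →+* ℂ, σ • z = σ' • z) → ∀ lam : k →+* ℂ, σ • lam = σ' • lam)
    (hkK : ∃ (σ : ℂ ≃+* ℂ) (lam : k →+* ℂ), (∀ x : K i₀ →+* ℂ, σ • x ∈ (Φ i₀).1 ↔ x ∈ (Φ i₀).1) ∧ σ • lam ≠ lam) :
    CMAlgebra.cmFamilyRank Φ = cmTypeRank (Φ i₁) + 3 := by
  have hflip := GenericCMField.pairFlip_of_finrank_normalClosure h6 L (Or.inr hL)
  have hΦ := isCMTypeWith_conj (Φ i₀)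
  have h := fun i => isCMTypeWith_conj (Φ i)
  -- the reflex slot `Y = Hom(K*, ℂ)`
  haveI := isPretransitive_ringEquiv_complex (K := Ks)
  haveI := isPretransitive_ringEquiv_complex (K := K i₀)
  have hY : ∀ y : Ks →+* ℂ, ∃ g : ℂ ≃+* ℂ, g • ψ₀ = y := fun y => MulAction.exists_smul_eq (ℂ ≃+* ℂ) ψ₀ y
  obtain ⟨T, hT, hTi, hT₀⟩ := ReflexSlot.exists_typeMap (G := ℂ ≃+* ℂ) (Φ₀ := (Φ i₀).1) (y₀ := ψ₀) hψ₀ hY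
  have h3 : (Φ i₀).1.ncard = 3 := by
    have := Literature.AlgebraicGeometry.Motives.HodgeStructure.two_mul_ncard_cmType_eq_finrank (Φ i₀); omega
  obtain ⟨x₁, x₂, x₃, h12, h13, h23, hx⟩ := Set.ncard_eq_three.1 h3
  obtain ⟨m₁, m₂, m₃⟩ := ReflexSlot.mem_of_eq_triple hx
  obtain ⟨φ₁, hφ₁⟩ := hflip x₁
  obtain ⟨φ₂, hφ₂⟩ := hflip x₂
  obtain ⟨φ₃, hφ₃⟩ := hflip x₃
  -- the pure transpositions (closure degree `48`)
  have hne := fun {a b : K i₀ →+* ℂ} (ha : a ∈ (Φ i₀).1) (hb : b ∈ (Φ i₀).1) =>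
    ReflexSlot.ne_rho_smul_of_mem hΦ ha hb
  obtain ⟨t, ht₁, ht₂, ht₃⟩ := exists_ringEquiv_transposition_of_finrank_eq h6 L hL h13 h23 (hne m₁ m₁) (hne m₁ m₂)
    (hne m₃ m₁) (hne m₂ m₂) (hne m₃ m₂)
  obtain ⟨t', ht'₁, ht'₂, ht'₃⟩ := exists_ringEquiv_transposition_of_finrank_eq h6 L hL h12 h23.symm (hne m₁ m₁)
    (hne m₁ m₃) (hne m₂ m₁) (hne m₃ m₃) (hne m₂ m₃)
  obtain ⟨t'', ht''₁, ht''₂, ht''₃⟩ := exists_ringEquiv_transposition_of_finrank_eq h6 L hL h12.symm h13.symm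
    (hne m₂ m₂) (hne m₂ m₃) (hne m₁ m₂) (hne m₃ m₃) (hne m₁ m₃)
  -- `t` swaps `x₁, x₂`; `t'` swaps `x₁, x₃`; `t''` swaps `x₂, x₃`
  -- the maps to `X = Hom(M, ℂ)` and `X_k = Hom(k, ℂ)`
  have h2' : finrank ℚ (K i₁) = 2 * finrank ℚ M := by rw [h8, h4M]
  have hqMρ : ∀ y : Ks →+* ℂ, ((starRingAut : ℂ ≃+* ℂ) • y).comp eM' = y.comp eM' := fun y => hMreal (y.comp eM')
  have hπMρ : ∀ y' : K i₁ →+* ℂ, ((starRingAut : ℂ ≃+* ℂ) • y').comp eM = y'.comp eM := fun y' => hMreal (y'.comp eM)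
  have hfib : ∀ y' y'' : K i₁ →+* ℂ, y'.comp eM = y''.comp eM → y'' = y' ∨ y'' = (starRingAut : ℂ ≃+* ℂ) • y' := by
    intro y' y'' hyy
    rcases forall_eq_or_eq_comp_eq eM h2' y' ((starRingAut : ℂ ≃+* ℂ) • y') y'' (hπMρ y').symm
        ((hπMρ y').trans hyy) with h' | h' | h'
    · exact absurd h'.symm ((h i₁).rho_smul_ne y')
    · exact Or.inr h'.symm
    · exact Or.inl h'.symm
  -- the imaginary quadratic slot
  obtain ⟨σ₀, κ₀, hσ₀Φ, hσ₀κ⟩ := hkK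
  have hkcard : Fintype.card (k →+* ℂ) = 2 := by rw [Embeddings.card, h2k]
  have hXk : ∀ lam : k →+* ℂ, lam = κ₀ ∨ lam = (starRingAut : ℂ ≃+* ℂ) • κ₀ := by
    intro lam
    by_contra hn
    push Not at hn
    have h3 : ({κ₀, (starRingAut : ℂ ≃+* ℂ) • κ₀, lam} : Finset (k →+* ℂ)).card = 3 := by
      rw [Finset.card_insert_of_notMem (by simp [(hkim κ₀).symm, Ne.symm hn.1]),
        Finset.card_pair (Ne.symm hn.2)]
    have := Finset.card_le_univ ({κ₀, (starRingAut : ℂ ≃+* ℂ) • κ₀, lam} : Finset (k →+* ℂ))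
    rw [h3, hkcard] at this
    omega
  have hκ : (starRingAut : ℂ ≃+* ℂ) • κ₀ ≠ κ₀ := hkim κ₀
  -- `σ₀` moves `κ₀`
  have hcomm : ∀ g : ℂ ≃+* ℂ, g • (starRingAut : ℂ ≃+* ℂ) • κ₀ = (starRingAut : ℂ ≃+* ℂ) • g • κ₀ := fun g =>
    (ReflexSlot.rho_smul_base hΦ hkL g).2
  -- products and conjugates of elements fixing `κ₀` fix `κ₀`
  have hmul := fun g g' => ReflexSlot.mul_smul_base_eq_iff (κ₀ := κ₀) hΦ hkL hXk hκ g g'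
  have hconj : ∀ c g : ℂ ≃+* ℂ, g • κ₀ = κ₀ → (c * g * c⁻¹) • κ₀ = κ₀ := by
    intro c g hg
    rw [hmul, hmul]
    have hc : c⁻¹ • κ₀ = κ₀ ↔ c • κ₀ = κ₀ := by
      rw [inv_smul_eq_iff]; exact ⟨fun h' => h'.symm, fun h' => h'.symm⟩
    rw [hc]; tauto
  -- `t` moves `κ₀`: otherwise every permutation of `Φ_T`, hence `σ₀`, fixes `κ₀`
  have htκ : t • κ₀ ≠ κ₀ := by
    intro ht0
    -- `t' ~ t'' t t''⁻¹` and `t'' ~ t' t t'⁻¹` on `Hom(K_T, ℂ)`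
    have agree : ∀ {g g' : ℂ ≃+* ℂ}, g • x₁ = g' • x₁ → g • x₂ = g' • x₂ → g • x₃ = g' • x₃ → g • κ₀ = g' • κ₀ :=
      fun {g g'} e1 e2 e3 => ReflexSlot.smul_base_eq_of_forall_mem hΦ hkL (ReflexSlot.forall_mem_of_triple hx e1 e2 e3)
    have it'' : t''⁻¹ • x₁ = x₁ := by rw [inv_smul_eq_iff, ht''₃]
    have it''2 : t''⁻¹ • x₃ = x₂ := by rw [inv_smul_eq_iff, ht''₁]
    have it''3 : t''⁻¹ • x₂ = x₃ := by rw [inv_smul_eq_iff, ht''₂]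
    have ht'0 : t' • κ₀ = κ₀ := by
      rw [← agree (g := t'' * t * t''⁻¹) (by rw [mul_smul, mul_smul, it'', ht₁, ht''₁, ht'₁])
        (by rw [mul_smul, mul_smul, it''3, ht₃, ht''₂, ht'₃]) (by rw [mul_smul, mul_smul, it''2, ht₂, ht''₃, ht'₂])]
      exact hconj t'' t ht0
    have it' : t'⁻¹ • x₂ = x₂ := by rw [inv_smul_eq_iff, ht'₃]
    have it'2 : t'⁻¹ • x₃ = x₁ := by rw [inv_smul_eq_iff, ht'₁]
    have it'3 : t'⁻¹ • x₁ = x₃ := by rw [inv_smul_eq_iff, ht'₂]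
    have ht''0 : t'' • κ₀ = κ₀ := by
      rw [← agree (g := t' * t * t'⁻¹) (by rw [mul_smul, mul_smul, it'3, ht₃, ht'₂, ht''₃])
        (by rw [mul_smul, mul_smul, it', ht₂, ht'₁, ht''₁]) (by rw [mul_smul, mul_smul, it'2, ht₁, ht'₃, ht''₂])]
      exact hconj t' t ht0
    -- `σ₀` permutes `Φ_T`
    have hσx : ∀ {x : K i₀ →+* ℂ}, x ∈ (Φ i₀).1 → σ₀ • x = x₁ ∨ σ₀ • x = x₂ ∨ σ₀ • x = x₃ := by
      intro x hxm
      have := (hσ₀Φ x).2 hxm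
      rw [hx] at this
      simpa using this
    have key : ∀ w : ℂ ≃+* ℂ, w • κ₀ = κ₀ → σ₀ • x₁ = w • x₁ → σ₀ • x₂ = w • x₂ → σ₀ • x₃ = w • x₃ → False :=
      fun w hw e1 e2 e3 => hσ₀κ ((agree e1 e2 e3).trans hw)
    have w12 := (hmul t' t).2 ⟨fun _ => ht0, fun _ => ht'0⟩
    have w21 := (hmul t t').2 ⟨fun _ => ht'0, fun _ => ht0⟩
    rcases hσx m₁ with e1 | e1 | e1 <;> rcases hσx m₂ with e2 | e2 | e2 <;> rcases hσx m₃ with e3 | e3 | e3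
    · exact absurd (smul_left_cancel σ₀ (e1.trans e2.symm)) h12
    · exact absurd (smul_left_cancel σ₀ (e1.trans e2.symm)) h12
    · exact absurd (smul_left_cancel σ₀ (e1.trans e2.symm)) h12
    · exact absurd (smul_left_cancel σ₀ (e1.trans e3.symm)) h13
    · exact absurd (smul_left_cancel σ₀ (e2.trans e3.symm)) h23
    · exact key 1 (one_smul _ _) (by rw [e1, one_smul]) (by rw [e2, one_smul]) (by rw [e3, one_smul])
    · exact absurd (smul_left_cancel σ₀ (e1.trans e3.symm)) h13
    · exact key t'' ht''0 (by rw [e1, ht''₃]) (by rw [e2, ht''₁]) (by rw [e3, ht''₂])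
    · exact absurd (smul_left_cancel σ₀ (e2.trans e3.symm)) h23
    · exact absurd (smul_left_cancel σ₀ (e2.trans e3.symm)) h23
    · exact absurd (smul_left_cancel σ₀ (e1.trans e3.symm)) h13
    · exact key t ht0 (by rw [e1, ht₁]) (by rw [e2, ht₂]) (by rw [e3, ht₃])
    · exact absurd (smul_left_cancel σ₀ (e1.trans e2.symm)) h12
    · exact absurd (smul_left_cancel σ₀ (e1.trans e2.symm)) h12
    · exact absurd (smul_left_cancel σ₀ (e1.trans e2.symm)) h12
    · exact key (t' * t) w12 (by rw [e1, mul_smul, ht₁, ht'₃]) (by rw [e2, mul_smul, ht₂, ht'₁])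
        (by rw [e3, mul_smul, ht₃, ht'₂])
    · exact absurd (smul_left_cancel σ₀ (e1.trans e3.symm)) h13
    · exact absurd (smul_left_cancel σ₀ (e2.trans e3.symm)) h23
    · exact absurd (smul_left_cancel σ₀ (e2.trans e3.symm)) h23
    · exact key (t * t') w21 (by rw [e1, mul_smul, ht'₁, ht₃]) (by rw [e2, mul_smul, ht'₃, ht₂])
        (by rw [e3, mul_smul, ht'₂, ht₁])
    · exact absurd (smul_left_cancel σ₀ (e1.trans e3.symm)) h13
    · exact key t' ht'0 (by rw [e1, ht'₁]) (by rw [e2, ht'₃]) (by rw [e3, ht'₂])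
    · exact absurd (smul_left_cancel σ₀ (e2.trans e3.symm)) h23
    · exact absurd (smul_left_cancel σ₀ (e1.trans e3.symm)) h13
    · exact absurd (smul_left_cancel σ₀ (e1.trans e2.symm)) h12
    · exact absurd (smul_left_cancel σ₀ (e1.trans e2.symm)) h12
    · exact absurd (smul_left_cancel σ₀ (e1.trans e2.symm)) h12
  -- the twin-slot rank theorem
  have hadd := ReflexSlot.typeRank_sigmaType_add_card_eq_of_twin (G := ℂ ≃+* ℂ) (E := fun i => K i →+* ℂ)
    (Y := Ks →+* ℂ) (X := M →+* ℂ) (Xk := k →+* ℂ) (Φ := fun i => (Φ i).1) (T := T) (y₀ := ψ₀)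
    (qM := fun y : Ks →+* ℂ => y.comp eM') (πM := fun y' : K i₁ →+* ℂ => y'.comp eM)
    (πk := fun y' : K i₁ →+* ℂ => y'.comp κ) (κ₀ := κ₀) h h01 hI hT hTi hT₀ hY hx h12 h13 h23 hφ₁ hφ₂ hφ₃
    ⟨ht₁, ht₂, ht₃⟩ (fun _ _ => rfl) hqMρ (fun μ => exists_comp_eq_of_embedding eM' μ) (fun _ _ => rfl)
    (fun μ => exists_comp_eq_of_embedding eM μ) (fun _ _ => rfl) hfib hkL hXk hκ htκ
  rw [ReflexSlot.card_eq_two h01 hI, ReflexSlot.sum_eq_add_of_two h01 hI] at hadd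
  have h0 : typeRank (ℂ ≃+* ℂ) (Φ i₀).1 = 4 := by
    have := GenericCMField.isNondegenerate_of_pairFlip hflip (Φ i₀)
    rw [isNondegenerate_iff, h6] at this
    exact this
  change typeRank (ℂ ≃+* ℂ) (CMAlgebra.familyType Φ) = typeRank (ℂ ≃+* ℂ) (Φ i₁).1 + 3
  have hfam : CMAlgebra.familyType Φ = sigmaType (fun i => (Φ i).1) := rfl
  rw [hfam]
  omega

/-- **The twin dichotomy**: `(Φ_T, Ψ')` is a nondegenerate family iff `Ψ'` is nondegenerate — no type of the twin
field `K'` pairs degenerately with `T`. [cite: Dodson1984, §5.1.2 and §3.3.2] [cite: Gordon1999HodgeAVSurvey, 7.5] -/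
theorem isNondegenerateFamily_iff_of_reflexTwin {i₀ i₁ : I} (h01 : i₀ ≠ i₁) (hI : ∀ j, j = i₀ ∨ j = i₁)
    (h6 : finrank ℚ (K i₀) = 6) (L : Type) [Field L] [NumberField L] [IsNormalClosure ℚ (K i₀) L]
    (hL : finrank ℚ L = 48) (Φ : ∀ i, CMType (K i))
    {Ks : Type} [Field Ks] [NumberField Ks] [IsCMField Ks] {ψ₀ : Ks →+* ℂ}
    (hψ₀ : ∀ σ : ℂ ≃+* ℂ, σ • ψ₀ = ψ₀ ↔ ∀ x : K i₀ →+* ℂ, σ • x ∈ (Φ i₀).1 ↔ x ∈ (Φ i₀).1)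
    {M : Type} [Field M] [NumberField M] (eM : M →+* K i₁) (eM' : M →+* Ks) (h4M : finrank ℚ M = 4)
    (hMreal : ∀ μ : M →+* ℂ, (starRingAut : ℂ ≃+* ℂ) • μ = μ) (h8 : finrank ℚ (K i₁) = 8)
    {k : Type} [Field k] [NumberField k] (κ : k →+* K i₁) (h2k : finrank ℚ k = 2)
    (hkim : ∀ lam : k →+* ℂ, (starRingAut : ℂ ≃+* ℂ) • lam ≠ lam)
    (hkL : ∀ σ σ' : ℂ ≃+* ℂ, (∀ z : K i₀ →+* ℂ, σ • z = σ' • z) → ∀ lam : k →+* ℂ, σ • lam = σ' • lam)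
    (hkK : ∃ (σ : ℂ ≃+* ℂ) (lam : k →+* ℂ), (∀ x : K i₀ →+* ℂ, σ • x ∈ (Φ i₀).1 ↔ x ∈ (Φ i₀).1) ∧ σ • lam ≠ lam) :
    CMAlgebra.IsNondegenerateFamily Φ ↔ IsNondegenerate (Φ i₁) := by
  haveI : Nonempty I := ⟨i₀⟩
  rw [CMAlgebra.isNondegenerateFamily_iff, ReflexSlot.sum_eq_add_of_two h01 hI, h6, h8,
    cmFamilyRank_eq_add_three_of_reflexTwin h01 hI h6 L hL Φ hψ₀ eM eM' h4M hMreal h8 κ h2k hkim hkL hkK,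
    isNondegenerate_iff, h8]
  omega

end Types

/-! ### §2 Geometry: `T^a × F'^b` -/

section Geometry

variable {I : Type} {K : I → Type} [∀ i, Field (K i)] [∀ i, NumberField (K i)] [∀ i, IsCMField (K i)] [Fintype I]
  {Φ : ∀ i, CMType (K i)}
variable {A : I → AbelianVariety ℂ} {ι : ∀ i, 𝓞 (K i) →+* End (A i)}
  {θ : ∀ i, K i →+* Module.End ℂ (complexBetti (A i).X 1)}

/-- **The Hodge conjecture and `B• = D•` on every `T^a × F'^b`** for a nondegenerate twin type `Ψ'`, UNCONDITIONALLY.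
[cite: Gordon1999HodgeAVSurvey, 7.5 and 10.10] [cite: Dodson1984, §5.1.2] -/
theorem hodgeConjectureFor_prod_of_reflexTwin {i₀ i₁ : I} (h01 : i₀ ≠ i₁) (hI : ∀ j, j = i₀ ∨ j = i₁)
    (h6 : finrank ℚ (K i₀) = 6) (L : Type) [Field L] [NumberField L] [IsNormalClosure ℚ (K i₀) L]
    (hL : finrank ℚ L = 48)
    {Ks : Type} [Field Ks] [NumberField Ks] [IsCMField Ks] {ψ₀ : Ks →+* ℂ}
    (hψ₀ : ∀ σ : ℂ ≃+* ℂ, σ • ψ₀ = ψ₀ ↔ ∀ x : K i₀ →+* ℂ, σ • x ∈ (Φ i₀).1 ↔ x ∈ (Φ i₀).1)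
    {M : Type} [Field M] [NumberField M] (eM : M →+* K i₁) (eM' : M →+* Ks) (h4M : finrank ℚ M = 4)
    (hMreal : ∀ μ : M →+* ℂ, (starRingAut : ℂ ≃+* ℂ) • μ = μ) (h8 : finrank ℚ (K i₁) = 8)
    {k : Type} [Field k] [NumberField k] (κ : k →+* K i₁) (h2k : finrank ℚ k = 2)
    (hkim : ∀ lam : k →+* ℂ, (starRingAut : ℂ ≃+* ℂ) • lam ≠ lam)
    (hkL : ∀ σ σ' : ℂ ≃+* ℂ, (∀ z : K i₀ →+* ℂ, σ • z = σ' • z) → ∀ lam : k →+* ℂ, σ • lam = σ' • lam)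
    (hkK : ∃ (σ : ℂ ≃+* ℂ) (lam : k →+* ℂ), (∀ x : K i₀ →+* ℂ, σ • x ∈ (Φ i₀).1 ↔ x ∈ (Φ i₀).1) ∧ σ • lam ≠ lam)
    (hΨ : IsNondegenerate (Φ i₁)) (hA : ∀ i, IsCMTypeRealisation (Φ i) (A i) (ι i) (θ i)) {N : ℕ}
    (π : Fin N → I) :
    HodgeConjectureFor (⨁ fun j : Fin N => A (π j)).dim (⨁ fun j : Fin N => A (π j)).X ∧
      ∀ m : ℕ, hodgeClassSpan (⨁ fun j : Fin N => A (π j)).dim (⨁ fun j : Fin N => A (π j)).X m =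
        divisorClassesSpan (⨁ fun j : Fin N => A (π j)).X (⨁ fun j : Fin N => A (π j)).dim m := by
  haveI : Nonempty I := ⟨i₀⟩
  have hnd := (isNondegenerateFamily_iff_of_reflexTwin h01 hI h6 L hL Φ hψ₀ eM eM' h4M hMreal h8 κ h2k hkim hkL
    hkK).2 hΨ
  exact ⟨hnd.hodgeConjectureFor_prod hA π, fun m => hnd.hodgeClassSpan_prod_eq_divisorClassesSpan hA π m⟩

end Geometry

end Summit.HodgeConjecture.CorCM

end
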